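import Summits.HodgeConjecture.HodgeConjecture.Theorems.Ring2HypothesesDescentAbsoluteExteriorGroups
import Literature.AlgebraicGeometry.Milne1999.SpecialLefschetzGroupInvariantsHolds
import Literature.AlgebraicGeometry.HodgeTheory.AbelianLowDimensionWeilReductionProofs
import Literature.AlgebraicGeometry.HodgeTheory.ExteriorPullback
import HarnessLib

/-!
# Ring 2 — hypotheses layer, descent axis: `G¹_alg(A)` INSIDE MILNE'S SPECIAL LEFSCHETZ GROUP `S(A)`, THE ACTION AS THE EXTERIOR
# PULL-BACK `⋀•(g₁)`, and «ABSOLUTE HODGE ⟹ LEFSCHETZ» PRICED BY `S(A) ≤ G¹_AH(A)` (Milne 1999 Cor. 4.5, PROVED in the tree)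

HONEST FRAMING (page 1, verbatim the cell's standing line): **research route conditional on HC_CM; not a
corollary; Q11.4-sentence-2 already refuted in dim ≥ 3.** Nothing in this file proves a case of the Hodge conjecture;
nothing discharges the binder of record b06 `Ring2.Hypotheses.AbsoluteHodgeImpliesAlgebraicAV` («absolute Hodge classes
on complex abelian varieties are algebraic», `Ring2HypothesesDescent.lean` :73; OPEN); the binder table's numbers do not
move. `HC_CM` (`Theses.RankFourFaces.CMAbelianHodge`), `HC_AV` and row b06 do not occur in this file; Charles–Schnell 11.2.18 AT
ONE abelian variety (`AbsoluteHodgeClassesAreAlgebraicFor A.dim A.X`, the per-variety form of the row) occurs as a CONCLUSION under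
an explicit group-theoretic hypothesis (§L3–§L4). Hodge ladder STAGE 3, `BINDER-OWNERS.md` row **b06**, seat `ring2-b06` (gen 84);
gen 81's residual (ii), last clause: «would let Milne's `S(A)`-invariants theorem price "AH ⟹ Lefschetz"». Companion of
`Ring2HypothesesDescentAbsoluteExteriorGroups` (same gen).

THE FIFTH GROUP. Milne's special Lefschetz group `S(A)(ℂ)` is in the tree Tannaka-free, as the stabiliser of the LEFSCHETZ classes
(`ℂ`-spans of products of rational `(1,1)`-classes) on the powers (`Milne1999.specialLefschetzGroup`, `Milne1999/LefschetzGroup`),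
with «`L(A) ⊃ Hg(A)`» (`Milne1999.hodgeGroup_le_specialLefschetzGroup`) and — PROVED by the Milne-1999 lane (`pub-hodgecm2`) — Cor. 4.5
/ Thm. 3.2: **the `S(A)`-invariants of `H^{2p}(A(ℂ); ℂ)` are Lefschetz classes** (`Milne1999_specialLefschetzGroup_invariants_le_holds`),
also in the `S(A)(ℂ) = U(C(A), †)`-form on `H¹` (`mem_divisorClassesSpan_of_forall_mem_unitaryCentralizerGroup`).

* §L1 **`g ∈ G¹_alg(A)(ℂ)` ACTS ON `Hᵏ(A(ℂ); ℂ)` AS THE EXTERIOR PULL-BACK `⋀ᵏ(g₁)`** (`algebraicStabilizer_toLinearMap_eq_exteriorPullback`: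
  the tree's `exteriorPullback` of `HodgeTheory/ExteriorPullback`, van Geemen 4.8 / Deligne (4.3)–(4.4)) — the `GL(H¹)`-form of the
  companion's `algebraicStabilizer_apply_cupPowOne`; the same for `G¹_AH(A)` (mod c23) and `G¹_mot(A)`.
* §L2 **`G¹_alg(A) ≤ S(A)`**, Tannaka-free and FACT-FREE (`algebraicStabilizer_le_specialLefschetzGroup`): Lefschetz classes on every
  power `A^{×(a+1)} = (A^{a+1}).X` are algebraic (Lefschetz `(1,1)`, the tree's `lefschetzOneOne_rational_holds`, and cup products with
  divisor classes on an abelian variety, `AbelianVariety.divisorClassesSpan_le_algebraicClasses`); hence the FULL TOWER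
  `Hg(A) ≤ G¹_AH(A) ≤ G¹_mot(A) ≤ G¹_alg(A) ≤ S(A)` in `∏ₖ GL(Hᵏ(A(ℂ); ℂ))` (`G¹_AH` links mod the facts of record, the rest fact-free).
* §L3 **«ABSOLUTE HODGE ⟹ LEFSCHETZ» ⟸ `S(A) ≤ G¹_AH(A)`** — FACT-FREE (`mem_divisorClassesSpan_of_isAbsoluteHodgeClass_of_le`: an
  absolute Hodge class is fixed by `G¹_AH(A)`, hence by `S(A)`, hence Lefschetz by Cor. 4.5), so **`S(A) ≤ G¹_AH(A) ⟹ 11.2.18 for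
  `A`** (`absoluteHodgeClassesAreAlgebraicFor_of_specialLefschetzGroup_le`, fact-free; Lefschetz classes are algebraic); conversely
  «AH ⟹ Lefschetz on all powers» ⟹ `S(A) ≤ G¹_AH(A)` (antitonicity; `specialLefschetzGroup_le_absoluteHodgeStabilizer_of_forall_subset`).
  In particular **Milne's condition (c) `Hg′(A) = S(A)` (no exotic Hodge class on any power) gives 11.2.18 for `A` WITHOUT Deligne's
  Main Theorem** (`absoluteHodgeClassesAreAlgebraicFor_of_hodgeGroup_eq_specialLefschetzGroup`; of course also via `HC(A)` — recorded
  as the AH-twin of `isDivisorGenerated_of_hodgeGroup_eq_specialLefschetzGroup`, not as a new case).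
* §L4 THE CONCRETE `GL(H¹)` CRITERION (mod c23): if Milne's unitary centraliser group `U(C(A) ⊗ ℂ, †_h) = unitaryCentralizerGroup A h`
  (`h ∈ B¹ ⊗ ℂ` with `Q_h` non-degenerate — a polarization) consists of `H¹`-components of elements of `G¹_AH(A)(ℂ)`, then 11.2.18
  holds for `A` (`absoluteHodgeClassesAreAlgebraicFor_of_unitaryCentralizerGroup_le`; §L1 + the `S(A)(ℂ)`-form of Cor. 4.5).

HONEST COLUMN. Nothing is discharged; «10 · 0» unchanged; no hypothesis of the cell occurs; V-B3 = c23
`deligne1982_cycleClass_absoluteHodge` is a fact OF RECORD displayed as `hZ` where `G¹_AH ≤ G¹_alg` is needed (§L1 AH form, §L4); no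
definition, no new named fact, no sorry. Mod c1 (`G¹_AH(A) = Hg(A)`, gen 81) the hypotheses of §L3–§L4 are Milne's (c) `Hg′(A) = S(A)`,
so NO NEW CASE of the row is claimed — the content is the fact-free pricing. NOT obtained: `S(A^r) = S(A)` diagonally (Milne Cor. 4.7)
Tannaka-free, whence §L3 only on `A` itself, not on its powers; anything deciding the row.

PRESEARCH. «Lefschetz group contains motivic Galois group; absolute Hodge classes Lefschetz; S(A)-invariants» → [corpus:
paper:doi-10-1215-s0012-7094-99-09620-5 (Milne 1999 Duke) Cor. 4.5, Prop. 4.8, Remark 4.9 (p. 659–660), as quoted in `Milne1999/LefschetzGroup`;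
paper:doi-10-1023-a-1000776613765 (Milne, Compositio 117) §1 p. 52]; corpus hybrid / vsearch «absolute Hodge classes are Lefschetz classes
abelian variety Mumford–Tate equals Lefschetz group» → Milne 1999 §4, Murty / Hazama (exceptional classes), the tree's barrier
`Weil1977_exceptionalHodgeClasses`; galaxy all stars «Lefschetz group|absolute Hodge|Lefschetz classes» → nothing pricing AH ⟹ Lefschetz by
`S(A) ≤ G^{AH}`; certification by assembly, no novelty claimed. References (bib keys): Milne1999LefschetzClasses (§4 Def. 4.3, Thm. 4.4,
Cor. 4.5, Cor. 4.7, Prop. 4.8, Rem. 4.9; Thm. 3.2), Milne1999 (§1), vanGeemen1994HodgeAV (§2.4, 4.8, 6.5), Deligne1982HodgeCycles (I §3,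
(4.3)–(4.4), Ex. 2.1 (a)), CharlesSchnell2014Notes (§11.2.5 (11.2.18)), VoisinHodgeI2002 (Thm. 11.30 Lefschetz (1,1)).
-/

noncomputable section

-- every declaration of this problem lives in `Summit.HodgeConjecture.HodgeConjecture.…` (summit = sub-problem)
set_option linter.dupNamespace false

namespace Summit.HodgeConjecture.HodgeConjecture.Ring2.Hypotheses

open CategoryTheory AlgebraicGeometry MonoidalCategory CartesianMonoidalCategory
open Literature.AlgebraicGeometry Literature.AlgebraicGeometry.Motives
open Literature.AlgebraicGeometry.HodgeTheory
open Literature.AlgebraicTopology.SingularHomology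
open Literature.Barriers.HodgeConjecture (divisorClassesSpan)
open Literature.AlgebraicGeometry.Milne1999 (specialLefschetzGroup lefschetzPowClasses unitaryCentralizerGroup
  Milne1999_specialLefschetzGroup_invariants_le_holds)

/-! ## §L1 The action of `G¹_alg(A)(ℂ)` on `Hᵏ` is the exterior pull-back `⋀ᵏ(g₁)` -/

section ExteriorPullback

variable {A : AbelianVariety ℂ} {g : ∀ k : ℕ, complexBetti A.X k ≃ₗ[ℂ] complexBetti A.X k}

/-- **`g_k = ⋀ᵏ(g₁)` for `g ∈ G¹_alg(A)(ℂ)`**: the degree-`k` component of an element of the stabiliser of the algebraic classes on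
the powers of `A` IS the exterior pull-back (`exteriorPullback`, `v₀ ∪ ⋯ ∪ v_{k-1} ↦ g₁v₀ ∪ ⋯ ∪ g₁v_{k-1}`) of its degree-`1`
component — the `GL(H¹)`-form of `algebraicStabilizer_apply_cupPowOne` («the algebra `End(X)_ℚ` [here: the group] acts through
`H¹`», van Geemen 4.8; Deligne (4.3)–(4.4)). [cite: vanGeemen1994HodgeAV, 4.8 and 6.5] [cite: Deligne1982HodgeCycles, (4.3)–(4.4)] -/
theorem algebraicStabilizer_toLinearMap_eq_exteriorPullback (hg : g ∈ algebraicStabilizer A.X) (k : ℕ) :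
    (g k : complexBetti A.X k →ₗ[ℂ] complexBetti A.X k) =
      exteriorPullback (AbelianVariety.hasExteriorCohomologyH1_complexPoints A)
        (g 1 : complexBetti A.X 1 →ₗ[ℂ] complexBetti A.X 1) k := by
  refine exteriorPullback_ext (AbelianVariety.hasExteriorCohomologyH1_complexPoints A) fun v ↦ ?_
  rw [LinearEquiv.coe_coe, algebraicStabilizer_apply_cupPowOne hg, exteriorPullback_cupPowOne]
  rfl

/-- Pointwise form: `g_k x = ⋀ᵏ(g₁) x`. [cite: vanGeemen1994HodgeAV, 4.8 and 6.5] -/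
theorem algebraicStabilizer_apply_eq_exteriorPullback (hg : g ∈ algebraicStabilizer A.X) (k : ℕ) (x : complexBetti A.X k) :
    g k x = exteriorPullback (AbelianVariety.hasExteriorCohomologyH1_complexPoints A)
      (g 1 : complexBetti A.X 1 →ₗ[ℂ] complexBetti A.X 1) k x := by
  rw [← algebraicStabilizer_toLinearMap_eq_exteriorPullback hg k, LinearEquiv.coe_coe]

/-- The same for `G¹_AH(A)(ℂ)` (mod V-B3 = c23, displayed): an element of the absolute Hodge stabiliser acts on `Hᵏ` as `⋀ᵏ` of
its `H¹`-component. [cite: Deligne1982HodgeCycles, I §3 Thm. 3.8 and (4.3)–(4.4)] [cite: vanGeemen1994HodgeAV, 6.5] -/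
theorem absoluteHodgeStabilizer_apply_eq_exteriorPullback (hZ : deligne1982_cycleClass_absoluteHodge)
    (hg : g ∈ powClassStabilizer A.X (fun a p ↦ {c : complexBetti (cartesianPow A.X (a + 1)) (2 * p) |
      IsAbsoluteHodgeClass (cartesianPowDim A.dim a) (cartesianPow A.X (a + 1)) p c}))
    (k : ℕ) (x : complexBetti A.X k) :
    g k x = exteriorPullback (AbelianVariety.hasExteriorCohomologyH1_complexPoints A)
      (g 1 : complexBetti A.X 1 →ₗ[ℂ] complexBetti A.X 1) k x :=
  algebraicStabilizer_apply_eq_exteriorPullback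
    (absoluteHodgeStabilizer_le_algebraicStabilizer hZ AbelianVariety.isSmoothProjective_holds hg) k x

/-- The same for André's `G¹_mot(A)(ℂ)` — FACT-FREE. [cite: Andre1996Motifs, §4.6 (ii) (p. 24)] [cite: vanGeemen1994HodgeAV, 4.8 and 6.5] -/
theorem specialMotivatedGaloisGroup_apply_eq_exteriorPullback (hg : g ∈ specialMotivatedGaloisGroup A.dim A.X) (k : ℕ)
    (x : complexBetti A.X k) :
    g k x = exteriorPullback (AbelianVariety.hasExteriorCohomologyH1_complexPoints A)
      (g 1 : complexBetti A.X 1 →ₗ[ℂ] complexBetti A.X 1) k x :=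
  algebraicStabilizer_apply_eq_exteriorPullback
    (specialMotivatedGaloisGroup_le_algebraicStabilizer AbelianVariety.isSmoothProjective_holds hg) k x

end ExteriorPullback

/-! ## §L2 `G¹_alg(A) ≤ S(A)`: the full tower `Hg ≤ G¹_AH ≤ G¹_mot ≤ G¹_alg ≤ S(A)` -/

section Tower

variable (A : AbelianVariety ℂ)

/-- **The Lefschetz classes on every power of `A` are algebraic** — FACT-FREE: on the abelian variety `A^{a+1}` (`A.powSucc a`,
whose underlying scheme IS `A.X^{×(a+1)}` and whose dimension IS `cartesianPowDim A.dim a`) the `ℂ`-span of the products of rational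
`(1,1)`-classes lies in `Nᵖ H²ᵖ` (Lefschetz `(1,1)`, the tree's `lefschetzOneOne_rational_holds`, and
`AbelianVariety.divisorClassesSpan_le_algebraicClasses`), i.e. Milne's system `lefschetzPowClasses` sits inside typer 2's
`algebraicPowClasses`. [cite: Milne1999LefschetzClasses, §4 p. 657 (`D_hom ⊂` algebraic classes)] [cite: VoisinHodgeI2002, Thm. 11.30]
[cite: vanGeemen1994HodgeAV, §2.4] -/
theorem lefschetzPowClasses_subset_algebraicPowClasses (a p : ℕ) :
    lefschetzPowClasses A.dim A.X a p ⊆ algebraicPowClasses A.X a p := by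
  -- Lefschetz `(1,1)` on the abelian variety `A^{a+1}`, in dimension `cartesianPowDim A.dim a`
  have hSP : IsSmoothProjective (cartesianPowDim A.dim a) (A.powSucc a).X := by
    rw [← AbelianVariety.dim_powSucc_eq_cartesianPowDim]
    exact AbelianVariety.isSmoothProjective_holds
  have h := AbelianVariety.divisorClassesSpan_le_algebraicClasses (A.powSucc a) (N := cartesianPowDim A.dim a)
    (fun b hb hb' ↦ lefschetzOneOne_rational_holds hSP b hb hb') p
  rw [AbelianVariety.powSucc_X_eq_cartesianPow] at h
  exact fun c hc ↦ h hc

/-- **`G¹_alg(A) ≤ S(A)`, Tannaka-free and FACT-FREE**: the stabiliser of the algebraic classes on the powers of `A` fixes every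
Lefschetz class on every power (they are algebraic), i.e. lies in Milne's special Lefschetz group (`Milne1999.specialLefschetzGroup`,
the stabiliser of the Lefschetz system) — «`L(A)` is the largest algebraic subgroup fixing `D_hom(A^r)`» read against any group fixing
MORE classes. [cite: Milne1999LefschetzClasses, Def. 4.3 and §4 p. 660 (`L(A) ⊃ Hg(A)`)] [cite: Andre1996Motifs, §4.6 (ii) (p. 24)] -/
theorem algebraicStabilizer_le_specialLefschetzGroup : algebraicStabilizer A.X ≤ specialLefschetzGroup A.dim A.X :=
  powClassStabilizer_anti (lefschetzPowClasses_subset_algebraicPowClasses A)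

/-- **THE FULL TOWER in `∏ₖ GL(Hᵏ(A(ℂ); ℂ))`**: `Hg(A) ≤ G¹_AH(A) ≤ G¹_mot(A) ≤ G¹_alg(A) ≤ S(A)` — the first link fact-free
(gen 81), the second mod V-B3 + T1c + CS7 + CS8 (André Prop. 2.5.1 at span level, gen 81), the last two FACT-FREE (typer 2; §L2).
Each group acts through `H¹` (companion file; §L1). [cite: Milne1999LefschetzClasses, §4 p. 660] [cite: Andre1996Motifs, §6.2 (p. 31)]
[cite: Deligne1982HodgeCycles, I §3 and §2 Example 2.1] -/
theorem tower_le_specialLefschetzGroup (hZ : deligne1982_cycleClass_absoluteHodge) (hL : deligne1982_lefschetz_absoluteHodge_iff)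
    (hcup : deligne1982_cupProduct_absoluteHodge) (hgys : deligne1982_gysinFst_absoluteHodge) :
    hodgeGroup A.dim A.X ≤ powClassStabilizer A.X (fun a p ↦ {c : complexBetti (cartesianPow A.X (a + 1)) (2 * p) |
        IsAbsoluteHodgeClass (cartesianPowDim A.dim a) (cartesianPow A.X (a + 1)) p c}) ∧
    powClassStabilizer A.X (fun a p ↦ {c : complexBetti (cartesianPow A.X (a + 1)) (2 * p) |
        IsAbsoluteHodgeClass (cartesianPowDim A.dim a) (cartesianPow A.X (a + 1)) p c}) ≤ specialMotivatedGaloisGroup A.dim A.X ∧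
    specialMotivatedGaloisGroup A.dim A.X ≤ algebraicStabilizer A.X ∧
    algebraicStabilizer A.X ≤ specialLefschetzGroup A.dim A.X :=
  ⟨hodgeGroup_le_absoluteHodgeStabilizer,
    absoluteHodgeStabilizer_le_specialMotivatedGaloisGroup hZ hL hcup hgys AbelianVariety.isSmoothProjective_holds,
    specialMotivatedGaloisGroup_le_algebraicStabilizer AbelianVariety.isSmoothProjective_holds,
    algebraicStabilizer_le_specialLefschetzGroup A⟩

end Tower

/-! ## §L3 «Absolute Hodge ⟹ Lefschetz» priced by `S(A) ≤ G¹_AH(A)` (Milne Cor. 4.5, proved in the tree) -/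

section Lefschetz

variable (A : AbelianVariety ℂ)

/-- **An absolute Hodge class on `A` is a LEFSCHETZ class as soon as `S(A) ≤ G¹_AH(A)`** — FACT-FREE: the class is fixed by every
element of `G¹_AH(A)(ℂ)` (the `a = 0` member of its Künneth family), hence by every element of `S(A)(ℂ)`, and the `S(A)`-invariants
of `H^{2p}(A(ℂ); ℂ)` are the Lefschetz classes `Dᵖ_hom(A)_ℂ` (Milne Cor. 4.5 / Thm. 3.2, the tree's THEOREM
`Milne1999_specialLefschetzGroup_invariants_le_holds`). [cite: Milne1999LefschetzClasses, Cor. 4.5 (p. 659) and Thm. 3.2 (p. 653)]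
[cite: Deligne1982HodgeCycles, I §3 Thm. 3.8] -/
theorem mem_divisorClassesSpan_of_isAbsoluteHodgeClass_of_le
    (hle : specialLefschetzGroup A.dim A.X ≤ powClassStabilizer A.X (fun a p ↦
      {c : complexBetti (cartesianPow A.X (a + 1)) (2 * p) | IsAbsoluteHodgeClass (cartesianPowDim A.dim a) (cartesianPow A.X (a + 1)) p c}))
    {p : ℕ} {c : complexBetti A.X (2 * p)} (hc : IsAbsoluteHodgeClass A.dim A.X p c) :
    c ∈ divisorClassesSpan A.X A.dim p :=
  Milne1999_specialLefschetzGroup_invariants_le_holds A p c fun _ hg ↦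
    apply_eq_self_of_mem_powClassStabilizer (hle hg) (p := p) (show c ∈ {c : complexBetti (cartesianPow A.X 1) (2 * p) |
      IsAbsoluteHodgeClass (cartesianPowDim A.dim 0) (cartesianPow A.X 1) p c} from hc)

/-- **`S(A) ≤ G¹_AH(A)` ⟹ Charles–Schnell 11.2.18 for `A`** (`AbsoluteHodgeClassesAreAlgebraicFor A.dim A.X`: every absolute Hodge
class on `A` is algebraic) — FACT-FREE: by the previous theorem such a class is Lefschetz, and Lefschetz classes of an abelian variety
are algebraic (Lefschetz `(1,1)` + cup products, `AbelianVariety.divisorClassesSpan_le_algebraicClasses`); the Hodge-model conjunct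
is the tree's `nonempty_hodgeModel_holds`. [cite: Milne1999LefschetzClasses, Cor. 4.5 (p. 659)] [cite: CharlesSchnell2014Notes, §11.2.5 (11.2.18)]
[cite: VoisinHodgeI2002, Thm. 11.30] -/
theorem absoluteHodgeClassesAreAlgebraicFor_of_specialLefschetzGroup_le
    (hle : specialLefschetzGroup A.dim A.X ≤ powClassStabilizer A.X (fun a p ↦
      {c : complexBetti (cartesianPow A.X (a + 1)) (2 * p) | IsAbsoluteHodgeClass (cartesianPowDim A.dim a) (cartesianPow A.X (a + 1)) p c})) :
    AbsoluteHodgeClassesAreAlgebraicFor A.dim A.X := by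
  refine ⟨nonempty_hodgeModel_holds AbelianVariety.isSmoothProjective_holds, fun p c hc ↦ ?_⟩
  exact AbelianVariety.divisorClassesSpan_le_algebraicClasses A
    (fun b hb hb' ↦ lefschetzOneOne_rational_holds (AbelianVariety.isSmoothProjective_holds (A := A)) b hb hb') p
    (mem_divisorClassesSpan_of_isAbsoluteHodgeClass_of_le A hle hc)

/-- Conversely, **«absolute Hodge ⟹ Lefschetz» on all powers of `A` forces `S(A) ≤ G¹_AH(A)`** (stabilisers are antitone): the AH
twin of Milne's Prop. 4.8 (a) ⟹ (c). [cite: Milne1999LefschetzClasses, Prop. 4.8 (p. 660)] -/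
theorem specialLefschetzGroup_le_absoluteHodgeStabilizer_of_forall_subset
    (h : ∀ a p, {c : complexBetti (cartesianPow A.X (a + 1)) (2 * p) |
      IsAbsoluteHodgeClass (cartesianPowDim A.dim a) (cartesianPow A.X (a + 1)) p c} ⊆ lefschetzPowClasses A.dim A.X a p) :
    specialLefschetzGroup A.dim A.X ≤ powClassStabilizer A.X (fun a p ↦
      {c : complexBetti (cartesianPow A.X (a + 1)) (2 * p) | IsAbsoluteHodgeClass (cartesianPowDim A.dim a) (cartesianPow A.X (a + 1)) p c}) :=
  powClassStabilizer_anti h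

/-- **Milne's condition (c) `Hg′(A) = S(A)` (no power of `A` supports an exotic Hodge class, Prop. 4.8) gives 11.2.18 for `A` WITHOUT
Deligne's Main Theorem** — FACT-FREE: `S(A) = Hg(A) ≤ G¹_AH(A)` (gen 81's `hodgeGroup_le_absoluteHodgeStabilizer`). (Also a consequence
of `HC(A)`, which (c) implies through `IsDivisorGenerated`; recorded as the AH twin of the tree's
`isDivisorGenerated_of_hodgeGroup_eq_specialLefschetzGroup`, not as a new case of the row.) [cite: Milne1999LefschetzClasses, Prop. 4.8 and Cor. 4.5 (pp. 659–660)]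
[cite: CharlesSchnell2014Notes, §11.2.5 (11.2.18)] -/
theorem absoluteHodgeClassesAreAlgebraicFor_of_hodgeGroup_eq_specialLefschetzGroup
    (h : hodgeGroup A.dim A.X = specialLefschetzGroup A.dim A.X) : AbsoluteHodgeClassesAreAlgebraicFor A.dim A.X :=
  absoluteHodgeClassesAreAlgebraicFor_of_specialLefschetzGroup_le A (h ▸ hodgeGroup_le_absoluteHodgeStabilizer)

end Lefschetz

/-! ## §L4 The concrete `GL(H¹)` criterion through Milne's unitary centraliser group `U(C(A) ⊗ ℂ, †)` -/

section Unitary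

variable (A : AbelianVariety ℂ)

/-- **11.2.18 for `A` from a subgroup of `GL(H¹(A(ℂ); ℂ))`** (mod V-B3 = c23, displayed): let `h ∈ B¹(A) ⊗ ℂ` with `Q_h` non-degenerate
on `H¹` (a polarization class). If every element of Milne's `S(A)(ℂ) = {u ∈ (C(A) ⊗ ℂ)^× | u†u = 1}` (`unitaryCentralizerGroup A h`: the
automorphisms of `H¹(A(ℂ); ℂ)` commuting with `End(A)` and preserving `Q_h`) is the `H¹`-component of an element of `G¹_AH(A)(ℂ)`, then
every absolute Hodge class on `A` is a Lefschetz class, hence algebraic. Proof: an AH class `c ∈ H^{2p}` is fixed by each such `g`,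
and `g` acts on `H^{2p}` as `⋀^{2p}(g₁) = ⋀^{2p}u` (§L1), so `c` is fixed by `⋀^{2p}u` for all `u ∈ S(A)(ℂ)`; conclude by the
`S(A)(ℂ)`-form of Cor. 4.5 (the tree's `mem_divisorClassesSpan_of_forall_mem_unitaryCentralizerGroup`).
[cite: Milne1999LefschetzClasses, §1 p. 644 (S(A)), Thm. 3.2 (p. 653), Cor. 4.5 (p. 659)] [cite: Deligne1982HodgeCycles, I §3 Thm. 3.8] -/
theorem absoluteHodgeClassesAreAlgebraicFor_of_unitaryCentralizerGroup_le (hZ : deligne1982_cycleClass_absoluteHodge)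
    {h : complexBetti A.X 2} (hh : h ∈ VanGeemen1994.hodgeClassSpan A.dim A.X 1)
    (hnd : ∀ x : complexBetti A.X 1, (∀ y, polarizationPairingOne A.X h (A.dim - 1) x y = 0) → x = 0)
    (hle : unitaryCentralizerGroup A h ≤ (powClassStabilizer A.X (fun a p ↦
      {c : complexBetti (cartesianPow A.X (a + 1)) (2 * p) |
        IsAbsoluteHodgeClass (cartesianPowDim A.dim a) (cartesianPow A.X (a + 1)) p c})).map
        (Pi.evalMonoidHom (fun k : ℕ ↦ complexBetti A.X k ≃ₗ[ℂ] complexBetti A.X k) 1)) :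
    AbsoluteHodgeClassesAreAlgebraicFor A.dim A.X := by
  refine ⟨nonempty_hodgeModel_holds AbelianVariety.isSmoothProjective_holds, fun p c hc ↦ ?_⟩
  refine AbelianVariety.divisorClassesSpan_le_algebraicClasses A
    (fun b hb hb' ↦ lefschetzOneOne_rational_holds (AbelianVariety.isSmoothProjective_holds (A := A)) b hb hb') p ?_
  refine Literature.AlgebraicGeometry.Milne1999.mem_divisorClassesSpan_of_forall_mem_unitaryCentralizerGroup A hh hnd p c
    fun u hu ↦ ?_
  obtain ⟨g, hg, rfl⟩ := Subgroup.mem_map.1 (hle hu)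
  change exteriorPullback _ (g 1 : complexBetti A.X 1 →ₗ[ℂ] complexBetti A.X 1) (2 * p) c = c
  rw [← absoluteHodgeStabilizer_apply_eq_exteriorPullback hZ hg (2 * p) c]
  exact apply_eq_self_of_mem_powClassStabilizer hg (p := p) (show c ∈ {c : complexBetti (cartesianPow A.X 1) (2 * p) |
    IsAbsoluteHodgeClass (cartesianPowDim A.dim 0) (cartesianPow A.X 1) p c} from hc)

end Unitary

end Summit.HodgeConjecture.HodgeConjecture.Ring2.Hypotheses

end
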